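import Mathlib
import Summits.Ventures.HodgeRepro2.T5LocalUnitsProfinite
import Summits.Ventures.HodgeRepro2.T5OpenCompactCharacterExtension

/-!
# Continuous characters of any subgroup of `Kˣ` extend, for a non-archimedean local field `K`

The instantiation of `T5OpenCompactCharacterExtension` on the cell's abstract local-field object
(`T5LocalUnitsProfinite`, row 46 of route/LEAN-ANNEX-p4.md): `K` a complete ultrametric
`NontriviallyNormedField` whose ring of integers `𝒪[K] = Valued.integer K` (under
`NormedField.toValued`) is a DVR with finite residue field.  The image `integerUnits` of `𝒪[K]ˣ`
in `Kˣ` is an OPEN subgroup (`𝒪[K]` is open in `K`), compact and totally disconnected (the closed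
embedding of the profinite group `𝒪[K]ˣ`), so every continuous character `H →* Circle` of ANY
subgroup `H ≤ Kˣ` — e.g. the image of `F_v^×` in `E_v^×` — extends to a continuous character of
`Kˣ` (`exists_continuous_extension_circle`), with the unitary `ℂˣ` form and the form through a
topological embedding `ι : A →* Kˣ` (`exists_continuous_comp_eq_of_isEmbedding`).

Mathlib's `v.adicCompletion K` carries all five hypotheses by instance search
(`T5AdicCompletionLocalField`, row 80), so the theorems apply to every finite place of a number
field; the pair `Kv ⊆ Lw` is `T5AdicCompletionEmbedding`.

Declaration per README §8(d): «uses an L-value-free non-vanishing device: NO».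
-/

namespace Summit.Ventures.HodgeRepro2.T5UnitsCharacterExtension

open Topology

attribute [local instance] NormedField.toValued

variable {K : Type*} [NontriviallyNormedField K] [IsUltrametricDist K]

/-- The inclusion `𝒪[K]ˣ →* Kˣ` (units of the subring `Valued.integer K`). -/
noncomputable abbrev unitsMap : (Valued.integer K)ˣ →* Kˣ :=
  Units.map ((Valued.integer K).subtype : Valued.integer K →* K)

/-- The image of `𝒪[K]ˣ` in `Kˣ`, as a subgroup. -/
noncomputable abbrev integerUnits : Subgroup Kˣ := (unitsMap (K := K)).range

/-- The inclusion `𝒪[K]ˣ →* Kˣ` on underlying elements. -/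
theorem unitsMap_apply (u : (Valued.integer K)ˣ) : ((unitsMap u : Kˣ) : K) = (u : Valued.integer K) := by
  simp [unitsMap]

/-- The inclusion `𝒪[K]ˣ →* Kˣ` is continuous. -/
theorem continuous_unitsMap : Continuous (unitsMap (K := K)) :=
  Units.continuous_map continuous_subtype_val

/-- The inclusion `𝒪[K]ˣ →* Kˣ` is injective. -/
theorem unitsMap_injective : Function.Injective (unitsMap (K := K)) :=
  Units.map_injective Subtype.val_injective

/-- A unit of `K` lies in the image of `𝒪[K]ˣ` iff it and its inverse are integral. -/
theorem mem_integerUnits_iff (x : Kˣ) :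
    x ∈ integerUnits (K := K) ↔
      (x : K) ∈ Valued.integer K ∧ ((x⁻¹ : Kˣ) : K) ∈ Valued.integer K := by
  constructor
  · rintro ⟨u, rfl⟩
    refine ⟨?_, ?_⟩
    · rw [unitsMap_apply]; exact (u : Valued.integer K).2
    · rw [← map_inv, unitsMap_apply]; exact ((u⁻¹ : (Valued.integer K)ˣ) : Valued.integer K).2
  · rintro ⟨h1, h2⟩
    refine ⟨⟨⟨(x : K), h1⟩, ⟨((x⁻¹ : Kˣ) : K), h2⟩, ?_, ?_⟩, ?_⟩
    · exact Subtype.ext (by simp)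
    · exact Subtype.ext (by simp)
    · exact Units.ext rfl

/-- `𝒪[K]ˣ` is open in `Kˣ`: it is the set of units `x` with `x` and `x⁻¹` in the open subring
`𝒪[K]`. -/
theorem isOpen_integerUnits : IsOpen ((integerUnits (K := K) : Subgroup Kˣ) : Set Kˣ) := by
  have : ((integerUnits (K := K) : Subgroup Kˣ) : Set Kˣ) =
      (Units.val ⁻¹' ((Valued.integer K : Subring K) : Set K)) ∩
        ((fun x : Kˣ => ((x⁻¹ : Kˣ) : K)) ⁻¹' ((Valued.integer K : Subring K) : Set K)) := by
    ext x
    simp only [SetLike.mem_coe, Set.mem_inter_iff, Set.mem_preimage]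
    exact mem_integerUnits_iff x
  rw [this]
  exact ((Valued.isOpen_integer K).preimage Units.continuous_val).inter
    ((Valued.isOpen_integer K).preimage Units.continuous_coe_inv)

/-- `integerUnits` as a set is the range of the inclusion `𝒪[K]ˣ →* Kˣ`. -/
theorem coe_integerUnits_eq_range :
    ((integerUnits (K := K) : Subgroup Kˣ) : Set Kˣ) = Set.range (unitsMap (K := K)) :=
  MonoidHom.coe_range _

section LocalField

variable [CompleteSpace K] [IsDiscreteValuationRing (Valued.integer K)]
  [Finite (Valued.ResidueField K)]

/-- `𝒪[K]ˣ` is compact in `Kˣ` (the continuous image of the compact group `𝒪[K]ˣ`, row 46). -/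
instance compactSpace_integerUnits : CompactSpace (integerUnits (K := K)) := by
  haveI := T5LocalUnitsProfinite.compactSpace_units (K := K)
  have hc : IsCompact (Set.range (unitsMap (K := K))) := isCompact_range continuous_unitsMap
  rw [← coe_integerUnits_eq_range] at hc
  exact isCompact_iff_compactSpace.mp hc

/-- The inclusion `𝒪[K]ˣ →* Kˣ` is a closed embedding. -/
theorem isClosedEmbedding_unitsMap : IsClosedEmbedding (unitsMap (K := K)) := by
  haveI := T5LocalUnitsProfinite.compactSpace_units (K := K)
  exact continuous_unitsMap.isClosedEmbedding unitsMap_injective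

/-- `𝒪[K]ˣ` is totally disconnected in `Kˣ` (the image of the profinite group `𝒪[K]ˣ` under a
closed embedding). -/
instance totallyDisconnectedSpace_integerUnits :
    TotallyDisconnectedSpace (integerUnits (K := K)) := by
  haveI := T5LocalUnitsProfinite.totallyDisconnectedSpace_units (K := K)
  have h1 : IsTotallyDisconnected (Set.range (unitsMap (K := K))) :=
    isClosedEmbedding_unitsMap.isEmbedding.isTotallyDisconnected_range.mpr inferInstance
  rw [← coe_integerUnits_eq_range] at h1
  exact (IsEmbedding.subtypeVal.isTotallyDisconnected_range).mp (by rwa [Subtype.range_coe])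

/-- The open subgroups of `Kˣ` form a basis of neighbourhoods of `1`. -/
theorem basis_units :
    ∀ W : Set Kˣ, IsOpen W → (1 : Kˣ) ∈ W → ∃ U : Subgroup Kˣ, IsOpen (U : Set Kˣ) ∧ (U : Set Kˣ) ⊆ W :=
  T5OpenCompactCharacterExtension.basis_of_isOpen_compact integerUnits isOpen_integerUnits

/-- Every continuous character of ANY subgroup `H ≤ Kˣ` extends to a continuous character of
`Kˣ`. -/
theorem exists_continuous_extension_circle (H : Subgroup Kˣ) (χ : H →* Circle)
    (hχ : Continuous χ) : ∃ χ' : Kˣ →* Circle, Continuous χ' ∧ ∀ h : H, χ' h = χ h :=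
  T5OpenCompactCharacterExtension.exists_continuous_extension_circle integerUnits
    isOpen_integerUnits H χ hχ

/-- The unitary `ℂˣ`-valued form. -/
theorem exists_continuous_extension_units (H : Subgroup Kˣ) (φ : H →* ℂˣ) (hφ : Continuous φ)
    (hunit : ∀ h : H, ‖(φ h : ℂ)‖ = 1) :
    ∃ φ' : Kˣ →* ℂˣ, Continuous φ' ∧ (∀ h : H, φ' h = φ h) ∧ ∀ g : Kˣ, ‖(φ' g : ℂ)‖ = 1 :=
  T5OpenCompactCharacterExtension.exists_continuous_extension_units integerUnits
    isOpen_integerUnits H φ hφ hunit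

variable {A : Type*} [CommGroup A] [TopologicalSpace A]

/-- Through a topological embedding `ι : A →* Kˣ` (the image of `F_v^×` in `E_v^×`): every
continuous character `η` of `A` is `μ ∘ ι` for a continuous character `μ` of `Kˣ`. -/
theorem exists_continuous_comp_eq_of_isEmbedding (ι : A →* Kˣ) (hι : IsEmbedding ι)
    (η : A →* Circle) (hη : Continuous η) :
    ∃ μ : Kˣ →* Circle, Continuous μ ∧ ∀ a : A, μ (ι a) = η a :=
  T5OpenCompactCharacterExtension.exists_continuous_comp_eq_of_isEmbedding integerUnits
    isOpen_integerUnits ι hι η hη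

/-- The unitary `ℂˣ`-valued form of `exists_continuous_comp_eq_of_isEmbedding`. -/
theorem exists_continuous_comp_eq_units_of_isEmbedding (ι : A →* Kˣ) (hι : IsEmbedding ι)
    (η : A →* ℂˣ) (hη : Continuous η) (hunit : ∀ a : A, ‖(η a : ℂ)‖ = 1) :
    ∃ μ : Kˣ →* ℂˣ, Continuous μ ∧ (∀ a : A, μ (ι a) = η a) ∧ ∀ g : Kˣ, ‖(μ g : ℂ)‖ = 1 :=
  T5OpenCompactCharacterExtension.exists_continuous_comp_eq_units_of_isEmbedding integerUnits
    isOpen_integerUnits ι hι η hη hunit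

end LocalField

end Summit.Ventures.HodgeRepro2.T5UnitsCharacterExtension
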